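import Mathlib
import Summits.NavierStokesRegularity.NavierStokesRegularity.Theorems.OrthantWakeOrthantBreakOfWake
import HarnessLib

/-!
# `OrthantWake.ForwardBreakOfWake` — the FORWARD-SOURCE tail-energy ratchet, cone invariance and
forward-source envelope smoothing give global pseudo-solutions for orthant tables
(item stmt-NavierStokesRegularity-26443; glue with content of route OrthantWake rev 3)

**Statement (verbatim route decl).** `ForwardHopWake → OrthantInvariance → ForwardSourceSmoothing →
∀ R ≥ 1, ∃ εR > 0, ∀ ε₀ ∈ (0, εR], ∀ α ∈ E₂(R) orthant, ∀ X₀, ¬ NoGlobalCascade ε₀ α X₀`.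

PROOF (the landed `orthantBreakOfWake_proof` of item 24641 with the total tail energies `T_n`
replaced by the forward-source tails `T⁺_n = Σ_{k≥n} Σ_{i∈S} ½X_{i,k}²`). Fix `R ≥ 1`;
`ForwardHopWake` gives `η, κ₁, ε̄`; take `εR = ε̄`. For `ε₀ ≤ ε̄`, an orthant table `α ∈ E₂(R)`
and a datum `X₀`, suppose `NoGlobalCascade ε₀ α X₀`; by the κ-normal form
(`noGlobalCascade_iff_kappa`) some defect level `κ > 0` carries no global pseudo-solution. Put
`ν = κ/√2`; `ForwardHopWake` supplies a source set `S ⊇ S⁺(α)` (every mode outside `S` has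
vanishing `(0,0,1)` output coefficients) and the `S`-ratchet for every regular non-negative
`ν`-viscous solution. We verify the hypothesis of `ForwardSourceSmoothing` at this `ν` and `S` with
the HORIZON-INDEPENDENT constant `C = E₀ (1+ε₀)^{(1+η) n₁}`, `E₀ = Σ_i ½X₀_i²`, `n₁ = ⌈κ₁/ε₀⌉`: for
a regular `ν`-viscous solution `X` on `[0,s]`,
* ENERGY (`orthantBreak_energy_le`): the total energy is `≤ E₀`, hence so is every
  forward-source tail `T⁺_a(u) ≤ T_a(u) ≤ E₀`;
* CONE: `OrthantInvariance` gives `X ≥ 0` on shells `≥ 1`, so the `S`-ratchet applies;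
* RATCHET ⇒ ENVELOPE (`forwardBreak_envelope`): beyond `n₁` each hop loses the factor
  `(1+ε₀)^{-(1+η)}`, hence `T⁺_n(t) ≤ C (1+ε₀)^{-(1+η)n}` for all `n`, uniformly in `t ≤ s`, `s`,
  and finite partial sums `Σ_{k=n}^{N} Σ_{i∈S}` are below the tail.
`ForwardSourceSmoothing` then yields a global regular viscous solution (`ViscousGlobal`), which is a
global `(κ, κ)`-pseudo-solution (`hasGlobal_of_viscousGlobal`, `hasGlobal_mono`) — contradiction.

HONEST FRAMING: statements about Tao-type MODEL lattice ODEs (route OrthantWake, rung TL-M2Break);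
all three hypotheses remain hypotheses (`ForwardHopWake` is the open crux, `ForwardSourceSmoothing`
the open smoothing extension); nothing here bears on Navier–Stokes regularity and no summit is
proved.
-/

noncomputable section

-- the sub-problem namespace `NavierStokesRegularity.NavierStokesRegularity` is the tree's layout (D-0017)
set_option linter.dupNamespace false

namespace Summit.NavierStokesRegularity.NavierStokesRegularity.Theorems

open Set Filter
open scoped Topology
open Literature.Analysis.FluidPDE.TaoCascade

/-! ## Forward-source tails: summability and the trivial bound by the total energy -/

/-- The `S`-restricted shell energies are dominated by the full shell energies. [this file] -/
theorem forwardBreak_sSum_le (S : Finset (Fin 4)) (X : Fin 4 → ℤ → ℝ → ℝ) (k : ℤ) (t : ℝ) :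
    ∑ i ∈ S, (1 / 2 : ℝ) * X i k t ^ 2 ≤ ∑ i : Fin 4, (1 / 2 : ℝ) * X i k t ^ 2 :=
  Finset.sum_le_univ_sum_of_nonneg fun i => by positivity

/-- The forward-source tail energies `j ↦ Σ_{i∈S} ½ X_{i,a+j}(t)²` of a family with the (4.5)
weight bound are summable (dominated by the full tails, `orthantBreak_summable`). [this file] -/
theorem forwardBreak_summable {ε₀ M : ℝ} (hε : 0 < ε₀) (S : Finset (Fin 4))
    {X : Fin 4 → ℤ → ℝ → ℝ}
    (hM : ∀ (t : ℝ) (i : Fin 4) (k : ℤ), (1 + (1 + ε₀) ^ ((10 : ℝ) * k)) * |X i k t| ≤ M)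
    (a : ℕ) (t : ℝ) :
    Summable fun j : ℕ => ∑ i ∈ S, (1 / 2 : ℝ) * X i ((a : ℤ) + (j : ℤ)) t ^ 2 :=
  Summable.of_nonneg_of_le (fun j => Finset.sum_nonneg fun i _ => by positivity)
    (fun j => forwardBreak_sSum_le S X _ t) (orthantBreak_summable hε hM a t)

/-! ## From the forward-source ratchet to the forward-source envelope -/

/-- **`S`-ratchet ⇒ `S`-envelope.** If the forward-source tails
`T⁺_a(u) = Σ_j Σ_{i∈S} ½X_{i,a+j}(u)²` are summable and `≤ E₀` on `[0,s]`, and beyond the transient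
depth (`ε₀ n ≥ κ₁`, in particular for `n ≥ n₁` when `κ₁ ≤ ε₀ n₁`) every hop ratchets `T⁺` down by
`(1+ε₀)^{-(1+η)}` against an earlier time, then every finite block obeys the subcritical envelope
`Σ_{k=n}^{N} Σ_{i∈S} ½X_{i,k}(t)² ≤ E₀ (1+ε₀)^{(1+η)n₁} (1+ε₀)^{-(1+η)n}` (the argument of
`orthantBreak_envelope`, verbatim for the restricted sums). [this file] -/
theorem forwardBreak_envelope {ε₀ η κ₁ s E₀ : ℝ} (hε : 0 < ε₀) {n₁ : ℕ} (hn₁ : κ₁ ≤ ε₀ * n₁)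
    (S : Finset (Fin 4)) {X : Fin 4 → ℤ → ℝ → ℝ}
    (hsum : ∀ (a : ℕ) (t : ℝ),
      Summable fun j : ℕ => ∑ i ∈ S, (1 / 2 : ℝ) * X i ((a : ℤ) + (j : ℤ)) t ^ 2)
    (hTle : ∀ (a : ℕ), ∀ t ∈ Icc (0 : ℝ) s,
      (∑' j : ℕ, ∑ i ∈ S, (1 / 2 : ℝ) * X i ((a : ℤ) + (j : ℤ)) t ^ 2) ≤ E₀)
    (hratchet : ∀ n : ℕ, κ₁ ≤ ε₀ * n → ∀ t ∈ Icc (0 : ℝ) s, ∃ u ∈ Icc (0 : ℝ) t,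
      (∑' j : ℕ, ∑ i ∈ S, (1 / 2 : ℝ) * X i ((n + 1 : ℕ) + (j : ℤ)) t ^ 2) ≤
        (1 + ε₀) ^ (-(1 + η)) *
          (∑' j : ℕ, ∑ i ∈ S, (1 / 2 : ℝ) * X i ((n : ℕ) + (j : ℤ)) u ^ 2))
    (hη : 0 < η) (n N : ℕ) {t : ℝ} (ht : t ∈ Icc (0 : ℝ) s) :
    ∑ k ∈ Finset.Icc n N, ∑ i ∈ S, (1 / 2 : ℝ) * X i (k : ℤ) t ^ 2 ≤
      (E₀ * (1 + ε₀) ^ ((1 + η) * n₁)) * (1 + ε₀) ^ (-((1 + η) * (n : ℝ))) := by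
  have h0 : (0 : ℝ) < 1 + ε₀ := by linarith
  have h1 : (1 : ℝ) ≤ 1 + ε₀ := by linarith
  set T : ℕ → ℝ → ℝ := fun a u =>
    ∑' j : ℕ, ∑ i ∈ S, (1 / 2 : ℝ) * X i ((a : ℤ) + (j : ℤ)) u ^ 2 with hT
  have hnonneg : ∀ (u : ℝ) (j : ℕ), 0 ≤ ∑ i ∈ S, (1 / 2 : ℝ) * X i (j : ℤ) u ^ 2 :=
    fun u j => Finset.sum_nonneg fun i _ => by positivity
  have hE0 : 0 ≤ E₀ := (tsum_nonneg fun j => hnonneg t (0 + j)).trans (by simpa using hTle 0 t ht)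
  -- iterate the ratchet from the transient depth
  have hiter : ∀ d : ℕ, ∀ u ∈ Icc (0 : ℝ) s,
      T (n₁ + d) u ≤ E₀ * (1 + ε₀) ^ (-((1 + η) * (d : ℝ))) := by
    intro d
    induction d with
    | zero =>
      intro u hu
      have h : T n₁ u ≤ E₀ := hTle n₁ u hu
      simpa using h
    | succ d ih =>
      intro u hu
      have hnd : κ₁ ≤ ε₀ * ((n₁ + d : ℕ) : ℝ) := by
        push_cast
        linarith [mul_add ε₀ (n₁ : ℝ) (d : ℝ),
          mul_nonneg hε.le (Nat.cast_nonneg d : (0 : ℝ) ≤ (d : ℝ))]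
      obtain ⟨v, hv, hle⟩ := hratchet (n₁ + d) hnd u hu
      have hv' : v ∈ Icc (0 : ℝ) s := ⟨hv.1, hv.2.trans hu.2⟩
      have h3 := ih v hv'
      have hr : 0 ≤ (1 + ε₀) ^ (-(1 + η)) := Real.rpow_nonneg h0.le _
      have hexp : -((1 + η) * ((d + 1 : ℕ) : ℝ)) = -(1 + η) + -((1 + η) * (d : ℝ)) := by
        push_cast
        ring
      calc T (n₁ + (d + 1)) u = T (n₁ + d + 1) u := rfl
        _ ≤ (1 + ε₀) ^ (-(1 + η)) * T (n₁ + d) v := hle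
        _ ≤ (1 + ε₀) ^ (-(1 + η)) * (E₀ * (1 + ε₀) ^ (-((1 + η) * (d : ℝ)))) :=
            mul_le_mul_of_nonneg_left h3 hr
        _ = E₀ * (1 + ε₀) ^ (-((1 + η) * ((d + 1 : ℕ) : ℝ))) := by
            rw [hexp, Real.rpow_add h0]
            ring
  -- the envelope for every shell
  have hTall : ∀ (a : ℕ), ∀ u ∈ Icc (0 : ℝ) s,
      T a u ≤ (E₀ * (1 + ε₀) ^ ((1 + η) * n₁)) * (1 + ε₀) ^ (-((1 + η) * (a : ℝ))) := by
    intro a u hu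
    rcases le_or_gt n₁ a with hle | hlt
    · obtain ⟨d, rfl⟩ := Nat.exists_eq_add_of_le hle
      have h := hiter d u hu
      have hexp : (1 + η) * (n₁ : ℝ) + -((1 + η) * ((n₁ + d : ℕ) : ℝ)) =
          -((1 + η) * (d : ℝ)) := by
        push_cast
        ring
      calc T (n₁ + d) u ≤ E₀ * (1 + ε₀) ^ (-((1 + η) * (d : ℝ))) := h
        _ = (E₀ * (1 + ε₀) ^ ((1 + η) * n₁)) *
              (1 + ε₀) ^ (-((1 + η) * ((n₁ + d : ℕ) : ℝ))) := by
            rw [mul_assoc, ← Real.rpow_add h0, hexp]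
    · have h := hTle a u hu
      have ha : (a : ℝ) ≤ n₁ := by exact_mod_cast hlt.le
      have hexp : (1 : ℝ) ≤ (1 + ε₀) ^ ((1 + η) * n₁) * (1 + ε₀) ^ (-((1 + η) * (a : ℝ))) := by
        rw [← Real.rpow_add h0]
        refine Real.one_le_rpow h1 ?_
        nlinarith [mul_nonneg (by linarith : (0 : ℝ) ≤ 1 + η) (sub_nonneg.2 ha)]
      calc T a u ≤ E₀ := h
        _ = E₀ * 1 := (mul_one _).symm
        _ ≤ E₀ * ((1 + ε₀) ^ ((1 + η) * n₁) * (1 + ε₀) ^ (-((1 + η) * (a : ℝ)))) :=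
            mul_le_mul_of_nonneg_left hexp hE0
        _ = (E₀ * (1 + ε₀) ^ ((1 + η) * n₁)) * (1 + ε₀) ^ (-((1 + η) * (a : ℝ))) := by ring
  -- finite blocks are below the tail
  have hsn : Summable fun j : ℕ => ∑ i ∈ S, (1 / 2 : ℝ) * X i ((n + j : ℕ) : ℤ) t ^ 2 :=
    (hsum n t).congr fun j => by simp [Nat.cast_add]
  have hpart := orthantBreak_partial_le
    (f := fun k : ℕ => ∑ i ∈ S, (1 / 2 : ℝ) * X i (k : ℤ) t ^ 2) (hnonneg t) n N hsn
  have h2 : ∑' j : ℕ, ∑ i ∈ S, (1 / 2 : ℝ) * X i ((n + j : ℕ) : ℤ) t ^ 2 = T n t := by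
    simp only [hT, Nat.cast_add]
  rw [h2] at hpart
  exact hpart.trans (hTall n t ht)

/-! ## The item -/

/-- **Item stmt-NavierStokesRegularity-26443** (`OrthantWake.ForwardBreakOfWake`): the per-hop
forward-source tail-energy ratchet (`ForwardHopWake`), Kamke cone invariance (`OrthantInvariance`)
and forward-source envelope smoothing (`ForwardSourceSmoothing`) imply the orthant conjunct of the
rung target — for every `R ≥ 1` there is `εR > 0` such that for `ε₀ ≤ εR` no orthant table of
`E₂(R)` exhibits Theorem-4.2-level blow-up from any one-shell datum. The envelope constant handed
to the smoothing hypothesis is `E₀ (1+ε₀)^{(1+η)⌈κ₁/ε₀⌉}`, independent of the horizon, the window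
and `ν`. MODEL lattice statement; no Navier–Stokes statement is proved. [this file] -/
theorem forwardBreakOfWake_proof :
    Summit.NavierStokesRegularity.NavierStokesRegularity.Theses.OrthantWake.ForwardBreakOfWake := by
  unfold Summit.NavierStokesRegularity.NavierStokesRegularity.Theses.OrthantWake.ForwardBreakOfWake
    Summit.NavierStokesRegularity.NavierStokesRegularity.Theses.OrthantWake.ForwardHopWake
    Summit.NavierStokesRegularity.NavierStokesRegularity.Theses.OrthantWake.OrthantInvariance
    Summit.NavierStokesRegularity.NavierStokesRegularity.Theses.OrthantWake.ForwardSourceSmoothing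
  intro hW hI hB R hR
  obtain ⟨η, hη, κ₁, _hκ₁, εb, hεb, _hεb1, H⟩ := hW R hR
  refine ⟨εb, hεb, fun ε₀ hε₀ hle α X₀ hα hK hNG => ?_⟩
  obtain ⟨κ, hκ, hno⟩ := (noGlobalCascade_iff_kappa hε₀).1 hNG
  have h2 : 0 < Real.sqrt 2 := Real.sqrt_pos.2 two_pos
  have hν : 0 < κ / Real.sqrt 2 := div_pos hκ h2
  -- the source set and the ratchet at this viscosity
  obtain ⟨S, hS, HS⟩ := H ε₀ hε₀ hle (κ / Real.sqrt 2) hν α hα hK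
  -- the transient depth in shells and the envelope constant
  obtain ⟨n₁, hn₁⟩ : ∃ n₁ : ℕ, κ₁ ≤ ε₀ * n₁ := by
    refine ⟨⌈κ₁ / ε₀⌉₊, ?_⟩
    have := Nat.le_ceil (κ₁ / ε₀)
    rwa [div_le_iff₀' hε₀] at this
  obtain ⟨X, hX⟩ := hB ε₀ η R hε₀ hη α hα S hS X₀ (κ / Real.sqrt 2) hν
    (fun T _hT => ⟨(∑ i : Fin 4, (1 / 2 : ℝ) * X₀ i ^ 2) * (1 + ε₀) ^ ((1 + η) * n₁),
      fun s hs Y hinit hlow hbd hcont hder n N _hnN t ht => by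
        obtain ⟨M, hM⟩ := hbd
        have hnonneg := hI ε₀ (κ / Real.sqrt 2) hε₀ hν α hK X₀ s hs.1 Y hinit hlow ⟨M, hM⟩
          hcont hder
        have hrat := HS X₀ s hs.1 Y hinit hlow ⟨M, hM⟩ hcont hder hnonneg
        -- every forward-source tail is below the total energy, hence below `E₀`
        have hTle : ∀ (a : ℕ), ∀ u ∈ Icc (0 : ℝ) s,
            (∑' j : ℕ, ∑ i ∈ S, (1 / 2 : ℝ) * Y i ((a : ℤ) + (j : ℤ)) u ^ 2) ≤
              ∑ i : Fin 4, (1 / 2 : ℝ) * X₀ i ^ 2 := by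
          intro a u hu
          have hfull := orthantBreak_summable hε₀ hM a u
          have hs0 : Summable fun j : ℕ => ∑ i : Fin 4, (1 / 2 : ℝ) * Y i (j : ℤ) u ^ 2 :=
            (orthantBreak_summable hε₀ hM 0 u).congr fun j => by simp
          have hnn : ∀ j : ℕ, 0 ≤ ∑ i : Fin 4, (1 / 2 : ℝ) * Y i (j : ℤ) u ^ 2 :=
            fun j => Finset.sum_nonneg fun i _ => by positivity
          calc (∑' j : ℕ, ∑ i ∈ S, (1 / 2 : ℝ) * Y i ((a : ℤ) + (j : ℤ)) u ^ 2)
              ≤ ∑' j : ℕ, ∑ i : Fin 4, (1 / 2 : ℝ) * Y i ((a : ℤ) + (j : ℤ)) u ^ 2 :=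
                (forwardBreak_summable hε₀ S hM a u).tsum_le_tsum
                  (fun j => forwardBreak_sSum_le S Y _ u) hfull
            _ = ∑' j : ℕ, ∑ i : Fin 4, (1 / 2 : ℝ) * Y i ((a + j : ℕ) : ℤ) u ^ 2 := by
                simp only [Nat.cast_add]
            _ ≤ ∑' j : ℕ, ∑ i : Fin 4, (1 / 2 : ℝ) * Y i (j : ℤ) u ^ 2 :=
                orthantBreak_tail_le hnn hs0 a
            _ ≤ ∑ i : Fin 4, (1 / 2 : ℝ) * X₀ i ^ 2 :=
                orthantBreak_energy_le hε₀ hν hα.2.1 hinit hlow hM hder hu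
        exact forwardBreak_envelope hε₀ hn₁ S (forwardBreak_summable hε₀ S hM) hTle hrat hη n N
          ht⟩)
  have hG := hasGlobal_of_viscousGlobal hε₀ hν.le hX
  rw [div_mul_cancel₀ κ h2.ne'] at hG
  exact hno (hasGlobal_mono hε₀.le hG le_rfl hκ.le)

end Summit.NavierStokesRegularity.NavierStokesRegularity.Theorems

end
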